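/-
Copyright (c) 2026. All rights reserved.
Released under Apache 2.0 license as described in the file LICENSE.
Authors: abc-iut cell, prover seat abc-iut-f-101 (F fact-proving wave), over the statements of abc-iut-L4-t3.
-/
import Literature.AnabelianGeometry.AbsoluteAnabelian.DiagramChainFamilies
import Literature.AnabelianGeometry.AbsoluteAnabelian.LogFrobeniusCorollaries
import HarnessLib

/-!
# [AbsTopIII] Corollary 5.5 (iii), `⊞`-half: the MOVE SYSTEM of the observable `S_log⊞` on `D•_{≤2} ∪ {𝒩⊞_v}` — generators, homotopies, termination, unique decomposition

S. Mochizuki, *Topics in absolute anabelian geometry III: global reconstruction algorithms*,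
J. Math. Sci. Univ. Tokyo 22 (2015) 939–1156 [MochizukiAbsTopIII2015]; locators `p.N` = pages of the author's
manuscript (`paper:url-5493eb38cbb7`): Def 5.4 (iii) p. 126, (v) p. 127, (vii) p. 128 (the graphs `Γ⃗^log_v`,
the twist `Λ_ν`, the `ι⊞_{v,ε}`), Cor 5.5 (iii) p. 131 (the observable `S_log⊞` on `D•_{≤2}` determined by the
`ι⊞_{v,ε}`), §0 p. 26 / Def 3.5 (ii) p. 75 (saturation; families of homotopies).

Preparation for the CONSTRUCTION of the observable `S_log⊞` of Cor 5.5 (iii) as typed by abc-iut-L4-t3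
(`LogFrobeniusSetting.IsLogObservablePlus`, `Cor55Observables` = FACT-LIST F-0142) from the commutativity of the
`ι⊞`-squares (the converse of `iota_comp_eq_of_cor55Observables`, `LogFrobeniusObservablesIotaSquare.lean`), via the
generated-family toolkit `DiagramChainFamilies.lean`.  The boundary set of `S_log⊞` is the saturation of the two
printed kinds of pairs; this file sets up the corresponding MOVE SYSTEM on the paths of `D•_{≤2} ∪ {𝒩⊞_v}` ending at
`𝒩⊞_v`:

* `LogFrobeniusSetting.LogGen` — the generator pairs: (`pre`) `([λ⊞_{ν₁}], [λ⊞_{ν₂}])` for an `ι⊞`-carrying edge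
  `ν₁ → ν₂` between pre-log vertices, (`post`) `([λ⊞_{sl}]∘[id_⋎]∘[log], [λ⊞_{ν₂}]∘[id_{⋎+1}])` for the edge out of
  the post-log vertex; `logGenHom` — their prescribed homotopies `ι⊞_{v,ε}`, re-typed along the identifications of
  the path functors (`pathFunctor_lamPath`, `pathFunctor_postLogDomPath`, …: `𝒟_[λ⊞_ν] = Λ_ν ⋙ λ⊞_ν`, using the
  proviso `λ⊞_{sl} = λ⊞_{post-log}` of Cor 5.5);
* TERMINATION: a rank on the vertices of `Γ⃗^log_v` (`LogVertex.rank`) decreasing along the `ι⊞`-carrying edges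
  (`rank_lt_of_logEdge`, `rank_lt_of_logEdge_post`), the induced weight of paths (`DEdge.wt`, `edgeWt`, `pathWt`,
  additive: `pathWt_comp`), and `pathWt_lt_of_move` / `pathWt_le_of_chain` / `pathWt_lt_of_cons`: every move of the
  toolkit's `Move (LogGen v)` strictly lowers the weight — no loops, well-founded;
* LOCAL STRUCTURE of `Γ⃗^log_v`, uniformly in the Boolean "archimedean" (`LogVertex.logEdge_subsingleton`,
  `isEmpty_logEdge_spaceLink`, `logEdge_post_target_eq`, `logEdge_fork`: the only fork out of a pre-log vertex is the
  nonarchimedean `𝒪^×_k̄ → {k̄^×, k~}`, closing at once into `(k̄^×)^pf` — the commutative square of Def 5.4 (iii));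
* UNIQUE DECOMPOSITION of paths into `𝒩⊞_v` (`eq_of_comp_lamPath_eq`, `eq_of_comp_lamPath_eq_comp_postLogDomPath`,
  `eq_of_comp_postLogDomPath_eq`): the first move of a chain out of a path is determined by the path up to the fork.

Nothing is asserted about print here (definitions and bookkeeping over the typed interface); the coherence theorem and
the construction of `S_log⊞` are in `LogFrobeniusObservablesOfIotaSquare.lean`.  Refereed pre-IUT material; nothing
here bears on [IUTchIII] Cor. 3.12; no side taken.
-/

set_option autoImplicit false

universe u

open CategoryTheory Quiver

namespace Literature.AnabelianGeometry.AbsoluteAnabelian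

/-! ## Combinatorics of `Γ⃗^log_v`: a rank decreasing along the `ι⊞`-carrying edges; forks; sinks -/

namespace LogVertex

/-- A rank on the vertices of `Γ⃗^log_v` that strictly DECREASES along every `ι⊞`-carrying edge out of a pre-log
vertex, and is `< 3 +` the rank of the space-link vertex at the target of the post-log edge (the termination measure
of the move system below). [cite: MochizukiAbsTopIII2015, Def 5.4 (iii) p. 126] -/
def rank : (b : Bool) → LogVertex b → ℕ
  | true, ArchVertex.pre => 2
  | true, ArchVertex.mult => 1
  | true, ArchVertex.spaceLink => 0
  | true, ArchVertex.postLog => 0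
  | false, NonarchVertex.units => 2
  | false, NonarchVertex.mult => 1
  | false, NonarchVertex.shellCod => 1
  | false, NonarchVertex.perf => 0
  | false, NonarchVertex.spaceLink => 3
  | false, NonarchVertex.postLog => 0

/-- The rank decreases along every `ι⊞`-carrying edge out of a pre-log vertex (`Γ⃗^⋉_non`: `𝒪^× ↪ k̄^×`,
`𝒪^× → k~`, `k̄^× → (k̄^×)^pf`, `k~ ↪ (k̄^×)^pf`; `Γ⃗^log_arc`: `k~ ↠ k^× ↪ k`). [cite: MochizukiAbsTopIII2015, Def 5.4 (iii) p. 126] -/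
theorem rank_lt_of_logEdge (b : Bool) {ν₁ ν₂ : LogVertex b} (ε : LogEdge b ν₁ ν₂) (h₁ : ν₁.isPostLog = false) :
    rank b ν₂ < rank b ν₁ := by
  cases b
  · obtain ⟨e, he⟩ := ε
    revert h₁ he
    cases e <;> simp [rank, NonarchEdge.InLeft, LogVertex.isPostLog, NonarchVertex.IsPostLog]
  · revert h₁ ε
    change ArchEdge ν₁ ν₂ → _
    intro e
    cases e <;> simp [rank, LogVertex.isPostLog, ArchVertex.IsPostLog]

/-- The target of the post-log edge has rank `< 3 + rank (space-link)`. [cite: MochizukiAbsTopIII2015, Def 5.4 (iii) p. 126] -/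
theorem rank_lt_of_logEdge_post (b : Bool) {ν₁ ν₂ : LogVertex b} (ε : LogEdge b ν₁ ν₂) (h₁ : ν₁.isPostLog = true) :
    rank b ν₂ < 3 + rank b (LogVertex.spaceLink b) := by
  cases b
  · obtain ⟨e, he⟩ := ε
    revert h₁ he
    cases e <;> simp [rank, NonarchEdge.InLeft, LogVertex.isPostLog, NonarchVertex.IsPostLog, LogVertex.spaceLink]
  · revert h₁ ε
    change ArchEdge ν₁ ν₂ → _
    intro e
    cases e <;> simp [rank, LogVertex.isPostLog, ArchVertex.IsPostLog, LogVertex.spaceLink]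

/-- There is at most one `ι⊞`-carrying edge between two vertices of `Γ⃗^log_v`. [cite: MochizukiAbsTopIII2015, Def 5.4 (iii) p. 126] -/
theorem logEdge_subsingleton (b : Bool) {ν₁ ν₂ : LogVertex b} (ε ε' : LogEdge b ν₁ ν₂) : ε = ε' := by
  cases b
  · obtain ⟨e, he⟩ := ε
    obtain ⟨e', he'⟩ := ε'
    congr 1
    cases e <;> cases e' <;> rfl
  · revert ε ε'
    change ∀ e e' : ArchEdge ν₁ ν₂, e = e'
    intro e e'
    cases e <;> cases e' <;> rfl

/-- The space-link vertex has no outgoing edge in `Γ⃗^log_v` (it is a sink: `k̄`, resp. `k`).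
[cite: MochizukiAbsTopIII2015, Def 5.4 (iii) p. 126] -/
theorem isEmpty_logEdge_spaceLink (b : Bool) (ν : LogVertex b) : IsEmpty (LogEdge b (LogVertex.spaceLink b) ν) := by
  cases b
  · refine ⟨fun ε => ?_⟩
    obtain ⟨e, -⟩ := ε
    revert e
    change NonarchEdge NonarchVertex.spaceLink ν → False
    intro e
    cases e
  · refine ⟨fun ε => ?_⟩
    revert ε
    change ArchEdge ArchVertex.spaceLink ν → False
    intro e
    cases e

/-- A vertex with an outgoing `ι⊞`-carrying edge towards a pre-log... (bookkeeping): the source of an edge out of a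
pre-log vertex is not the space-link vertex. [cite: MochizukiAbsTopIII2015, Def 5.4 (iii) p. 126] -/
theorem ne_spaceLink_of_logEdge (b : Bool) {ν₁ ν₂ : LogVertex b} (ε : LogEdge b ν₁ ν₂) :
    ν₁ ≠ LogVertex.spaceLink b := by
  rintro rfl
  exact (isEmpty_logEdge_spaceLink b ν₂).false ε

/-- Out of the post-log vertex there is exactly one edge (the post-log arrow `k~ → k~`): its target is determined.
[cite: MochizukiAbsTopIII2015, Def 5.4 (iii) p. 126] -/
theorem logEdge_post_target_eq (b : Bool) {ν₁ ν₂ ν₂' : LogVertex b} (h₁ : ν₁.isPostLog = true)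
    (ε : LogEdge b ν₁ ν₂) (ε' : LogEdge b ν₁ ν₂') : ν₂ = ν₂' := by
  cases b
  · obtain ⟨e, he⟩ := ε
    obtain ⟨e', he'⟩ := ε'
    cases e <;> cases e' <;>
      first | rfl | exact he.elim | exact he'.elim | exact absurd h₁ (by decide)
  · change ArchEdge _ _ at ε
    change ArchEdge _ _ at ε'
    cases ε <;> cases ε' <;> rfl

/-- Out of `k̄^×` the only `ι⊞`-carrying edge goes to `(k̄^×)^pf`. [cite: MochizukiAbsTopIII2015, Def 5.4 (iii) p. 126] -/
theorem eq_perf_of_logEdge_mult {ν : LogVertex false} (γ : LogEdge false NonarchVertex.mult ν) :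
    ν = NonarchVertex.perf := by
  obtain ⟨g, hg⟩ := γ
  cases g
  · exact hg.elim
  · rfl

/-- Out of `k~` (the shell codomain) the only edge goes to `(k̄^×)^pf`. [cite: MochizukiAbsTopIII2015, Def 5.4 (iii) p. 126] -/
theorem eq_perf_of_logEdge_shellCod {ν : LogVertex false} (γ : LogEdge false NonarchVertex.shellCod ν) :
    ν = NonarchVertex.perf := by
  obtain ⟨g, -⟩ := γ
  cases g
  rfl

/-- **The forks of `Γ⃗^⋉_v`.**  Two DISTINCT `ι⊞`-carrying edges out of one pre-log vertex exist only at a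
nonarchimedean place, out of `𝒪^×_k̄` (towards `k̄^×` and `k~`), and the fork closes at once: both targets are pre-log
of the same rank and have exactly one outgoing edge, into a common pre-log vertex `(k̄^×)^pf` (the commutative square
of Def 5.4 (iii)).  Stated uniformly in the Boolean `b`. [cite: MochizukiAbsTopIII2015, Def 5.4 (iii) p. 126] -/
theorem logEdge_fork (b : Bool) {ν₁ ν₂ ν₂' : LogVertex b} (h₁ : ν₁.isPostLog = false) (ε : LogEdge b ν₁ ν₂)
    (ε' : LogEdge b ν₁ ν₂') (hne : ν₂ ≠ ν₂') :
    ∃ (ν₃ : LogVertex b) (_ : LogEdge b ν₂ ν₃) (_ : LogEdge b ν₂' ν₃),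
      ν₂.isPostLog = false ∧ ν₂'.isPostLog = false ∧ ν₃.isPostLog = false ∧ rank b ν₂ = rank b ν₂' ∧
      (∀ (ν₄ : LogVertex b), LogEdge b ν₂ ν₄ → ν₄ = ν₃) ∧ (∀ (ν₄ : LogVertex b), LogEdge b ν₂' ν₄ → ν₄ = ν₃) := by
  cases b
  · obtain ⟨e, he⟩ := ε
    obtain ⟨e', he'⟩ := ε'
    cases e <;> cases e' <;>
      first
        | exact absurd rfl hne
        | exact he.elim
        | exact he'.elim
        | exact absurd h₁ (by decide)
        | exact ⟨NonarchVertex.perf, ⟨.multToPerf, trivial⟩, ⟨.shellCodToPerf, trivial⟩, by decide, by decide,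
            by decide, rfl, fun _ γ => eq_perf_of_logEdge_mult γ, fun _ γ => eq_perf_of_logEdge_shellCod γ⟩
        | exact ⟨NonarchVertex.perf, ⟨.shellCodToPerf, trivial⟩, ⟨.multToPerf, trivial⟩, by decide, by decide,
            by decide, rfl, fun _ γ => eq_perf_of_logEdge_shellCod γ, fun _ γ => eq_perf_of_logEdge_mult γ⟩
  · change ArchEdge _ _ at ε
    change ArchEdge _ _ at ε'
    cases ε <;> cases ε' <;> exact absurd rfl hne

/-- A pre-log vertex with `isPostLog = true` is absurd (bookkeeping). [cite: MochizukiAbsTopIII2015, Def 5.4 (iii) p. 126] -/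
theorem eq_postLog_of_isPostLog (b : Bool) {ν : LogVertex b} (h : ν.isPostLog = true) : ν = LogVertex.postLog b := by
  cases b
  · change NonarchVertex at ν
    cases ν <;> first | rfl | exact absurd h (by decide)
  · change ArchVertex at ν
    cases ν <;> first | rfl | exact absurd h (by decide)

end LogVertex

/-! ## The move system of `D•_{≤2} ∪ {𝒩⊞_v}`: weights, generators, homotopies -/

namespace LogFrobeniusSetting

variable {Vmod : Type u} {isArc : Vmod → Bool} (L : LogFrobeniusSetting Vmod isArc) (v : Vmod)

/-- The weight of an arrow of `D•⊢`: `3` for `log`, the rank of `ν` for `λ⊞_{v,ν}`, `0` otherwise.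
[cite: MochizukiAbsTopIII2015, Cor 5.5 (iii) p. 131] -/
def _root_.Literature.AnabelianGeometry.AbsoluteAnabelian.DEdge.wt :
    {a b : DVertex Vmod isArc} → DEdge isArc a b → ℕ
  | _, _, .log _ => 3
  | _, _, .lam _ ν _ => LogVertex.rank _ ν
  | _, _, _ => 0

/-- The weight of an arrow of `D•_{≤2} ∪ {𝒩⊞_v}` (that of the underlying arrow of `D•⊢`).
[cite: MochizukiAbsTopIII2015, Cor 5.5 (iii) p. 131] -/
def edgeWt : {c d : (logShapePlus (isArc := isArc) v).Vertex} → (c ⟶ d) → ℕ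
  | ExtVertex.base _, ExtVertex.base _, e => DEdge.wt e
  | ExtVertex.base _, ExtVertex.obs, e => DEdge.wt e
  | ExtVertex.obs, _, _ => 0

/-- The weight of a path of `D•_{≤2} ∪ {𝒩⊞_v}` (sum of the weights of its arrows).
[cite: MochizukiAbsTopIII2015, Cor 5.5 (iii) p. 131] -/
def pathWt {c : (logShapePlus (isArc := isArc) v).Vertex} :
    {d : (logShapePlus (isArc := isArc) v).Vertex} → Path c d → ℕ
  | _, Path.nil => 0
  | _, Path.cons p e => pathWt p + edgeWt v e

/-- The weight is additive along composition of paths. [cite: MochizukiAbsTopIII2015, Cor 5.5 (iii) p. 131] -/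
theorem pathWt_comp {c d d' : (logShapePlus (isArc := isArc) v).Vertex} (r : Path c d) :
    ∀ (p : Path d d'), pathWt v (r.comp p) = pathWt v r + pathWt v p
  | Path.nil => rfl
  | Path.cons p e => by rw [Path.comp_cons, pathWt, pathWt, pathWt_comp r p, Nat.add_assoc]

/-- Weight of `[λ⊞_{v,ν}]`. [cite: MochizukiAbsTopIII2015, Cor 5.5 (iii) p. 131] -/
theorem pathWt_lamPath (ν : LogVertex (isArc v)) (hν : ν.isPostLog = false) :
    pathWt v (lamPath (isArc := isArc) v ν hν) = LogVertex.rank _ ν := by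
  show 0 + LogVertex.rank _ ν = _
  exact Nat.zero_add _

/-- Weight of `[λ⊞_{sl}] ∘ [id_⋎] ∘ [log]`. [cite: MochizukiAbsTopIII2015, Cor 5.5 (iii) p. 131] -/
theorem pathWt_postLogDomPath (n : ℤ) (hsl : (LogVertex.spaceLink (isArc v)).isPostLog = false) :
    pathWt v (postLogDomPath (isArc := isArc) v n hsl) = 3 + LogVertex.rank _ (LogVertex.spaceLink (isArc v)) := by
  show ((0 + 3) + 0) + LogVertex.rank _ (LogVertex.spaceLink (isArc v)) = _
  omega

/-- Weight of `[λ⊞_{ν₂}] ∘ [id_{⋎+1}]`. [cite: MochizukiAbsTopIII2015, Cor 5.5 (iii) p. 131] -/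
theorem pathWt_postLogCodPath (n : ℤ) (ν₂ : LogVertex (isArc v)) (h₂ : ν₂.isPostLog = false) :
    pathWt v (postLogCodPath (isArc := isArc) v n ν₂ h₂) = LogVertex.rank _ ν₂ := by
  show (0 + 0) + LogVertex.rank _ ν₂ = _
  omega

/-- **The generator pairs of the observable `S_log⊞`** (Cor 5.5 (iii)): (`pre`) `([λ⊞_{ν₁}], [λ⊞_{ν₂}])` for an
`ι⊞`-carrying edge `ε : ν₁ → ν₂` between pre-log vertices; (`post`) `([λ⊞_{sl}]∘[id_⋎]∘[log], [λ⊞_{ν₂}]∘[id_{⋎+1}])` for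
an edge out of the post-log vertex. [cite: MochizukiAbsTopIII2015, Cor 5.5 (iii) p. 131] -/
inductive LogGen : ∀ ⦃c b : (logShapePlus (isArc := isArc) v).Vertex⦄, Path c b → Path c b → Type u
  | pre (ν₁ ν₂ : LogVertex (isArc v)) (ε : LogEdge (isArc v) ν₁ ν₂) (h₁ : ν₁.isPostLog = false)
      (h₂ : ν₂.isPostLog = false) : LogGen (lamPath v ν₁ h₁) (lamPath v ν₂ h₂)
  | post (ν₁ ν₂ : LogVertex (isArc v)) (ε : LogEdge (isArc v) ν₁ ν₂) (h₁ : ν₁.isPostLog = true)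
      (h₂ : ν₂.isPostLog = false) (hsl : (LogVertex.spaceLink (isArc v)).isPostLog = false) (n : ℤ) :
      LogGen (postLogDomPath v n hsl) (postLogCodPath v n ν₂ h₂)

/-- The path functor of `[λ⊞_{ν}]` is `Λ_ν ⋙ λ⊞_ν` (`Λ_ν = 𝟭` at a pre-log vertex).
[cite: MochizukiAbsTopIII2015, Def 5.4 (vii) p. 128] -/
theorem pathFunctor_lamPath (ν : LogVertex (isArc v)) (hν : ν.isPostLog = false) :
    (L.logDiagramPlus v).pathFunctor (lamPath v ν hν) = frobeniusTwist L.log ν.isPostLog ⋙ L.lam v ν := by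
  rw [lamPath, DiagramOfCategories.pathFunctor_cons, DiagramOfCategories.pathFunctor_nil, hν]
  rfl

/-- … and is `λ⊞_ν` itself (with `𝟭 ⋙ -` removed). [cite: MochizukiAbsTopIII2015, Def 5.4 (vii) p. 128] -/
theorem pathFunctor_lamPath' (ν : LogVertex (isArc v)) (hν : ν.isPostLog = false) :
    L.lam v ν = (L.logDiagramPlus v).pathFunctor (lamPath v ν hν) := by
  rw [lamPath, DiagramOfCategories.pathFunctor_cons, DiagramOfCategories.pathFunctor_nil]
  exact (Functor.id_comp _).symm

/-- The path functor of `[λ⊞_{sl}]∘[id_⋎]∘[log]` is `Λ_{ν₁} ⋙ λ⊞_{ν₁}` for the post-log vertex `ν₁` (`Λ = log`, and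
`λ⊞_{sl} = λ⊞_{post-log}` by the proviso of Cor 5.5). [cite: MochizukiAbsTopIII2015, Def 5.4 (vii) p. 128] -/
theorem pathFunctor_postLogDomPath (ν₁ : LogVertex (isArc v)) (h₁ : ν₁.isPostLog = true) (n : ℤ)
    (hsl : (LogVertex.spaceLink (isArc v)).isPostLog = false) :
    (L.logDiagramPlus v).pathFunctor (postLogDomPath v n hsl) = frobeniusTwist L.log ν₁.isPostLog ⋙ L.lam v ν₁ := by
  rw [postLogDomPath, DiagramOfCategories.pathFunctor_cons, DiagramOfCategories.pathFunctor_cons,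
    DiagramOfCategories.pathFunctor_cons, DiagramOfCategories.pathFunctor_nil, h₁,
    LogVertex.eq_postLog_of_isPostLog _ h₁, ← L.lam_spaceLink_eq_postLog v]
  rfl

/-- The path functor of `[λ⊞_{ν₂}]∘[id_{⋎+1}]` is `λ⊞_{ν₂}`. [cite: MochizukiAbsTopIII2015, Def 5.4 (vii) p. 128] -/
theorem pathFunctor_postLogCodPath (n : ℤ) (ν₂ : LogVertex (isArc v)) (h₂ : ν₂.isPostLog = false) :
    L.lam v ν₂ = (L.logDiagramPlus v).pathFunctor (postLogCodPath v n ν₂ h₂) := by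
  rw [postLogCodPath, DiagramOfCategories.pathFunctor_cons, DiagramOfCategories.pathFunctor_cons,
    DiagramOfCategories.pathFunctor_nil]
  rfl

/-- **The prescribed homotopies of the generators**: `ι⊞_{v,ε}`, re-typed along the identifications of the path
functors. [cite: MochizukiAbsTopIII2015, Cor 5.5 (iii) p. 131] -/
noncomputable def logGenHom : ∀ ⦃c b : (logShapePlus (isArc := isArc) v).Vertex⦄ ⦃g g' : Path c b⦄,
    LogGen v g g' → ((L.logDiagramPlus v).pathFunctor g ⟶ (L.logDiagramPlus v).pathFunctor g')
  | _, _, _, _, LogGen.pre ν₁ ν₂ ε h₁ h₂ =>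
    eqToHom (L.pathFunctor_lamPath v ν₁ h₁) ≫ L.iota v ε ≫ eqToHom (L.pathFunctor_lamPath' v ν₂ h₂)
  | _, _, _, _, LogGen.post ν₁ ν₂ ε h₁ h₂ hsl n =>
    eqToHom (L.pathFunctor_postLogDomPath v ν₁ h₁ n hsl) ≫ L.iota v ε ≫ eqToHom (L.pathFunctor_postLogCodPath v n ν₂ h₂)

/-! ## Termination: every move lowers the weight -/

/-- **Every move lowers the weight of the path** (by `rank_lt_of_logEdge`, `rank_lt_of_logEdge_post`): the move
system terminates and has no loops. [cite: MochizukiAbsTopIII2015, Cor 5.5 (iii) p. 131] -/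
theorem pathWt_lt_of_move {a : (logShapePlus (isArc := isArc) v).Vertex} {p p' : Path a (logShapePlus v).obs}
    (m : DiagramOfCategories.Move (LogGen v) p p') : pathWt v p' < pathWt v p := by
  obtain ⟨c, r, g, g', s, hp, hp'⟩ := m
  cases s with
  | pre ν₁ ν₂ ε h₁ h₂ =>
    rw [hp, hp', pathWt_comp, pathWt_comp, pathWt_lamPath, pathWt_lamPath]
    exact Nat.add_lt_add_left (LogVertex.rank_lt_of_logEdge _ ε h₁) _
  | post ν₁ ν₂ ε h₁ h₂ hsl n =>
    rw [hp, hp', pathWt_comp, pathWt_comp, pathWt_postLogDomPath, pathWt_postLogCodPath]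
    exact Nat.add_lt_add_left (LogVertex.rank_lt_of_logEdge_post _ ε h₁) _

/-- Along a chain of moves the weight does not increase. [cite: MochizukiAbsTopIII2015, Cor 5.5 (iii) p. 131] -/
theorem pathWt_le_of_chain {a : (logShapePlus (isArc := isArc) v).Vertex} {p q : Path a (logShapePlus v).obs}
    (c : DiagramOfCategories.Chain (LogGen v) p q) : pathWt v q ≤ pathWt v p := by
  induction c with
  | nil p => exact le_rfl
  | cons m rest ih => exact ih.trans (pathWt_lt_of_move v m).le

/-- A chain with a first move strictly lowers the weight. [cite: MochizukiAbsTopIII2015, Cor 5.5 (iii) p. 131] -/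
theorem pathWt_lt_of_cons {a : (logShapePlus (isArc := isArc) v).Vertex} {p p' q : Path a (logShapePlus v).obs}
    (m : DiagramOfCategories.Move (LogGen v) p p') (rest : DiagramOfCategories.Chain (LogGen v) p' q) :
    pathWt v q < pathWt v p :=
  (pathWt_le_of_chain v rest).trans_lt (pathWt_lt_of_move v m)

/-! ## Unique decomposition of the paths of `D•_{≤2} ∪ {𝒩⊞_v}` ending at `𝒩⊞_v` -/

/-- Two presentations `p = [λ⊞_ν] ∘ r = [λ⊞_{ν'}] ∘ r'` have the same last arrow and the same prefix.
[cite: MochizukiAbsTopIII2015, Cor 5.5 (iii) p. 131] -/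
theorem eq_of_comp_lamPath_eq {a : (logShapePlus (isArc := isArc) v).Vertex}
    {r r' : Path a ((logShapePlus (isArc := isArc) v).base ⟨.core, core_mem_two⟩)} {ν ν' : LogVertex (isArc v)}
    {h : ν.isPostLog = false} {h' : ν'.isPostLog = false}
    (e : r.comp (lamPath v ν h) = r'.comp (lamPath v ν' h')) : ν = ν' ∧ r = r' := by
  change r.cons (lamEdge v ν h) = r'.cons (lamEdge v ν' h') at e
  have hν : lamEdge (isArc := isArc) v ν h = lamEdge v ν' h' := eq_of_heq (Path.hom_heq_of_cons_eq_cons e)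
  have hr : r = r' := eq_of_heq (Path.heq_of_cons_eq_cons e)
  refine ⟨?_, hr⟩
  change DEdge.lam v ν h = DEdge.lam v ν' h' at hν
  injection hν

/-- A presentation `[λ⊞_ν] ∘ r = ([λ⊞_{sl}] ∘ [id_⋎] ∘ [log]) ∘ r'` forces `ν = sl` and `r = [id_⋎] ∘ [log] ∘ r'`.
[cite: MochizukiAbsTopIII2015, Cor 5.5 (iii) p. 131] -/
theorem eq_of_comp_lamPath_eq_comp_postLogDomPath {a : (logShapePlus (isArc := isArc) v).Vertex}
    {r : Path a ((logShapePlus (isArc := isArc) v).base ⟨.core, core_mem_two⟩)} {ν : LogVertex (isArc v)}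
    {h : ν.isPostLog = false} {n : ℤ} {r' : Path a ((logShapePlus (isArc := isArc) v).base ⟨.row1 (n + 1), row1_mem_two (n + 1)⟩)}
    {hsl : (LogVertex.spaceLink (isArc v)).isPostLog = false}
    (e : r.comp (lamPath v ν h) = r'.comp (postLogDomPath v n hsl)) :
    ν = LogVertex.spaceLink (isArc v) ∧ r = (r'.cons (logEdge v n)).cons (toCoreEdge v n) := by
  change r.cons (lamEdge v ν h) = ((r'.cons (logEdge v n)).cons (toCoreEdge v n)).cons (lamEdge v _ hsl) at e
  have hν : lamEdge (isArc := isArc) v ν h = lamEdge v _ hsl := eq_of_heq (Path.hom_heq_of_cons_eq_cons e)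
  have hr : r = (r'.cons (logEdge v n)).cons (toCoreEdge v n) := eq_of_heq (Path.heq_of_cons_eq_cons e)
  refine ⟨?_, hr⟩
  change DEdge.lam v ν h = DEdge.lam v _ hsl at hν
  injection hν

/-- Two presentations `([λ⊞_{sl}] ∘ [id_⋎] ∘ [log]) ∘ r = ([λ⊞_{sl}] ∘ [id_{⋎'}] ∘ [log]) ∘ r'` have `⋎ = ⋎'` and `r = r'`.
[cite: MochizukiAbsTopIII2015, Cor 5.5 (iii) p. 131] -/
theorem eq_of_comp_postLogDomPath_eq {a : (logShapePlus (isArc := isArc) v).Vertex} {n n' : ℤ}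
    {r : Path a ((logShapePlus (isArc := isArc) v).base ⟨.row1 (n + 1), row1_mem_two (n + 1)⟩)}
    {r' : Path a ((logShapePlus (isArc := isArc) v).base ⟨.row1 (n' + 1), row1_mem_two (n' + 1)⟩)}
    {hsl hsl' : (LogVertex.spaceLink (isArc v)).isPostLog = false}
    (e : r.comp (postLogDomPath v n hsl) = r'.comp (postLogDomPath v n' hsl')) : n = n' ∧ HEq r r' := by
  change ((r.cons (logEdge v n)).cons (toCoreEdge v n)).cons (lamEdge v _ hsl) =
    ((r'.cons (logEdge v n')).cons (toCoreEdge v n')).cons (lamEdge v _ hsl') at e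
  have e₂ : (r.cons (logEdge v n)).cons (toCoreEdge v n) = (r'.cons (logEdge v n')).cons (toCoreEdge v n') :=
    eq_of_heq (Path.heq_of_cons_eq_cons e)
  have hn : ((logShapePlus (isArc := isArc) v).base ⟨.row1 n, row1_mem_two n⟩) =
      (logShapePlus (isArc := isArc) v).base ⟨.row1 n', row1_mem_two n'⟩ := Path.obj_eq_of_cons_eq_cons e₂
  have hn' : n = n' := by
    change ExtVertex.base _ = ExtVertex.base _ at hn
    injection hn with hn
    injection hn with hn
    injection hn
  subst hn'
  have e₃ : r.cons (logEdge v n) = r'.cons (logEdge v n) := eq_of_heq (Path.heq_of_cons_eq_cons e₂)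
  exact ⟨rfl, Path.heq_of_cons_eq_cons e₃⟩

end LogFrobeniusSetting

end Literature.AnabelianGeometry.AbsoluteAnabelian
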